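import Literature.NumberTheory.IwasawaTheory.ClassicalMuInvariantOnePrimeProofs
import Mathlib.NumberTheory.NumberField.InfinitePlace.TotallyRealComplex
import Mathlib.NumberTheory.NumberField.Units.DirichletTheorem
import Mathlib.RingTheory.Ideal.Norm.AbsNorm
import Mathlib.LinearAlgebra.FreeModule.IdealQuotient
import HarnessLib

/-!
# X3, the DEGENERATE rows, class-level count: the LAYERS `ℚ_N` of a `ℤ_p`-extension of `ℚ` as
# NUMBER FIELDS — totally real, unit rank `[ℚ_N : ℚ] − 1`, and `#(𝓞/3𝓞) = 3^{[K:ℚ]}`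
# (cell `bsd-eis`, seat `bsd-eis-x3` gen 9; brick U3/U7 of x3-MEMO-11; route K1 `AdditiveBranchIMC`,
# crux `GordTwoRankZeroOffCaseOne` — supports only)

HONEST FRAMING (`run/shared/lean/pub/bsd-eis/README.md` §4): THEOREMS ONLY (no `def`, no named fact,
no `sorry`); nothing is booked; no label, tier or count of record moves.

## What
* `ZpExtension.isTotallyReal_layer_rat` — every layer `ℚ_N` of a `ℤ_p`-extension of `ℚ` is TOTALLY
  REAL: the layers are unramified at the infinite places (tree
  `ZpExtension.isUnramifiedAtInfinitePlaces_layer`, Washington Prop. 13.2) and `ℚ` is totally real.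
* `ZpExtension.units_rank_layer_rat` — Dirichlet: `rank (𝓞 ℚ_N)ˣ = [ℚ_N : ℚ] − 1 = p^N − 1`
  (tree `ZpExtension.finrank_layer_holds`).
* `KummerFamily.natCard_quot_span_natCast` — for any number field `K` and `m : ℕ`:
  `#(𝓞_K ⧸ m𝓞_K) = m^{[K:ℚ]}` (Mathlib `Ideal.absNorm_span_singleton`, `Algebra.norm_algebraMap`).
These are the inputs U3/U7 of the class-level U-side count (`3ⁿ − 1` fundamental units of the layer;
the local target `(R/9R)ˣ/cubes` of order `≤ #(𝓞/3) = 3^{3^N}`).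
References: [Washington1997] §13.1 Prop. 13.2; [NeukirchANT1999] Ch. I (7.4), (11.6)–(11.7).
-/

set_option autoImplicit false

noncomputable section

open scoped NumberField

namespace Literature.NumberTheory.EllipticCurves.ZpExtension

open NumberField NumberField.InfinitePlace Field

variable {p : ℕ} [Fact p.Prime] (κ : ZpExtension ℚ p)

/-- **The layers of a `ℤ_p`-extension of `ℚ` are totally real**: an infinite place `w` of `ℚ_N` is
unramified over `ℚ` (Washington Prop. 13.2, tree `isUnramifiedAtInfinitePlaces_layer`), and its
restriction to `ℚ` is real, so `w` is real (`InfinitePlace.not_isUnramified_iff`).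
[cite: Washington1997, §13.1 Prop. 13.2] -/
theorem isTotallyReal_layer_rat (N : ℕ) : IsTotallyReal (κ.layer N) := by
  haveI : FiniteDimensional ℚ (κ.layer N) := κ.finiteDimensional_layer_holds N
  haveI : NumberField (κ.layer N) := NumberField.of_module_finite ℚ (κ.layer N)
  haveI : IsUnramifiedAtInfinitePlaces ℚ (κ.layer N) := κ.isUnramifiedAtInfinitePlaces_layer N
  refine ⟨fun w ↦ ?_⟩
  by_contra hw
  have hunr : w.IsUnramified ℚ := IsUnramifiedAtInfinitePlaces.isUnramified w
  have hram : ¬ w.IsUnramified ℚ := by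
    rw [InfinitePlace.not_isUnramified_iff]
    exact ⟨not_isReal_iff_isComplex.mp hw, IsTotallyReal.isReal _⟩
  exact hram hunr

/-- **Dirichlet for the layers: `rank (𝓞 ℚ_N)ˣ = p^N − 1`** (`ℚ_N` totally real of degree `p^N`).
[cite: NeukirchANT1999, Ch. I (7.4)] [cite: Washington1997, §13.1] -/
theorem units_rank_layer_rat (N : ℕ) :
    haveI : FiniteDimensional ℚ (κ.layer N) := κ.finiteDimensional_layer_holds N
    haveI : NumberField (κ.layer N) := NumberField.of_module_finite ℚ (κ.layer N)
    NumberField.Units.rank (κ.layer N) = p ^ N - 1 := by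
  haveI : FiniteDimensional ℚ (κ.layer N) := κ.finiteDimensional_layer_holds N
  haveI : NumberField (κ.layer N) := NumberField.of_module_finite ℚ (κ.layer N)
  haveI : IsTotallyReal (κ.layer N) := κ.isTotallyReal_layer_rat N
  rw [NumberField.Units.rank, card_eq_nrRealPlaces_add_nrComplexPlaces,
    IsTotallyReal.nrComplexPlaces_eq_zero, add_zero, ← IsTotallyReal.finrank, κ.finrank_layer_holds N]

end Literature.NumberTheory.EllipticCurves.ZpExtension

namespace Summit.BirchSwinnertonDyer.Rank1Residual.Additive

namespace KummerFamily

open NumberField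

/-- **`#(𝓞_K ⧸ m 𝓞_K) = m^{[K:ℚ]}`** for a number field `K` and `m : ℕ`: the absolute norm of the
principal ideal `(m)` is `|N_{K/ℚ}(m)| = m^{[K:ℚ]}`. [cite: NeukirchANT1999, Ch. I (7.4)] -/
theorem natCard_quot_span_natCast (K : Type*) [Field K] [NumberField K] (m : ℕ) :
    Nat.card (𝓞 K ⧸ Ideal.span {(m : 𝓞 K)}) = m ^ Module.finrank ℚ K := by
  have h := Ideal.absNorm_span_singleton (m : 𝓞 K)
  rw [Ideal.absNorm_apply, Submodule.cardQuot_apply] at h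
  rw [h, show (m : 𝓞 K) = algebraMap ℤ (𝓞 K) (m : ℤ) by simp, Algebra.norm_algebraMap,
    RingOfIntegers.rank, Int.natAbs_pow, Int.natAbs_natCast]

/-- `𝓞_K ⧸ m 𝓞_K` is finite for `m ≠ 0`. [cite: NeukirchANT1999, Ch. I (7.4)] -/
theorem finite_quot_span_natCast (K : Type*) [Field K] [NumberField K] {m : ℕ} (hm : m ≠ 0) :
    Finite (𝓞 K ⧸ Ideal.span {(m : 𝓞 K)}) := by
  refine Ideal.finiteQuotientOfFreeOfNeBot _ ?_
  rw [Ne, Ideal.span_singleton_eq_bot]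
  exact_mod_cast hm

end KummerFamily

end Summit.BirchSwinnertonDyer.Rank1Residual.Additive

end
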